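import Mathlib.NumberTheory.EulerProduct.DirichletLSeries
import Mathlib.NumberTheory.SumPrimeReciprocals
import Mathlib.Analysis.SpecialFunctions.Complex.LogBounds
import Mathlib.Analysis.SpecialFunctions.Pow.Deriv
import Mathlib.Analysis.Calculus.Deriv.Slope
import Mathlib.Analysis.Complex.RealDeriv
import Literature.NumberTheory.LFunctions.LocalGHLRepulsion
import Literature.NumberTheory.EllipticCurves.SymmSquareLogEulerProduct
import Literature.NumberTheory.EllipticCurves.NewformPeterssonSizeSymmSqLZeroFreeProofs
import Literature.NumberTheory.Automorphic.KimSymmetricFourthGL2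
import HarnessLib

/-!
# `murty_petersson_newform_lower_bound` from the analytic package of `L(s, Sym⁴ E)` (Kim 2003):
# the Goldfeld–Hoffstein–Lieman argument on the Siegel ball

Topic `Literature/NumberTheory/EllipticCurves`, namespace
`Literature.NumberTheory.EllipticCurves.ModularForms` (grouping namespace `SymmFourGHL` for the
auxiliary lemmas). Everything here is PROVED (theorems only; no definition, no named fact).

**Main theorem** (`murty_petersson_newform_lower_bound_of_symmFour`): the named fact
`murty_petersson_newform_lower_bound` (`NewformPeterssonSize.lean`: `c_ε N^{1−ε} ≤ Re ⟨f, f⟩` for the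
newform `f` of every elliptic curve over `ℚ`; Murty 1999 / Hoffstein–Lockhart 1994 Thm. 0.1) FOLLOWS
from the single named fact `Literature.NumberTheory.Automorphic.Kim2003_symmFourL_nonCM_entire_polyBound`
(`Automorphic/KimSymmetricFourthGL2.lean`: for non-CM `E/ℚ` the good-prime symmetric fourth power Euler
product is the restriction of an entire function bounded by `C N^K` on `|s − 2| ≤ 3/2`; Kim 2003
Thm. B, Kim–Shahidi 2002, Godement–Jacquet, convexity). With the tree this pins the fact to ONE
automorphic input. The route (Goldfeld–Hoffstein–Lieman, appendix to Hoffstein–Lockhart 1994;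
Iwaniec–Kowalski Thm. 5.44 and (5.104)):

1. (`SymmFourGHL.exists_GHL_auxiliary`, `SymmFourGHL.exists_GHL_auxiliary_newform`) For a newform
   `f ∈ S₂(Γ₀(N))` with `L_f = symmSqL N f` (the continued imprimitive symmetric square,
   `RankinSymmSquareGL2Fields`), `corr(s) = ∏_{p∣N}(1 + p^{-s})` and an entire `L₄` which on
   `Re s > 1` is the exponential of the good-prime symmetric-fourth log-series, the auxiliary function
   `Z = ζ² (L_f·corr)³ L₄` has non-negative log-coefficients (`2 + 3(P_k² − 1) + (P_k⁴ − 3P_k² + 1) = P_k⁴`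
   at `p ∤ N`; `2/k + 3p^{-k}/k`, resp. `2/k`, at `p ∥ N`, resp. `p² ∣ N` — the log-Euler product of
   `L_f·corr` is `IsNewform0.symmSqL_mul_corr_eq_exp_logEuler`, `SymmSquareLogEulerProduct.lean`),
   hence on the real axis right of `1`: `Z = exp(T)`, `T ≥ 0` antitone, so `|Z| ≥ 1`, `Re Z'/Z ≤ 0`
   (`SymmFourGHL.exists_realAxis_exp`); and `G = ζ₁² (dslope (L_f·corr) β)³ L₄` is holomorphic on the
   Siegel ball `|s − 1| < r` with `(s − β)³ G = (s − 1)² Z`, `|(s − β)³G| ≤ e^B`, `B ≤ A log(N + 2)`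
   (disc bound `exists_norm_symmSqL_le` with the self-improving proviso `L_f(1) < 1`, `|ζ₁| ≤ 21`,
   `|corr| ≤ N`, `|L₄| ≤ C N^K`), zero-free on `Re s > 1`.
2. (`symmSqL_nonCM_zeroFree_of_symmFour`) The disc-local repulsion lemma
   `GoldfeldHoffsteinLieman1994.realZero_le_local` (`LFunctions/LocalGHLRepulsion.lean`, `m = 2`,
   `ρ = r`) then gives `A > 0` with: for every NON-CM elliptic newform with `L_f(1) < 1`,
   `L_f(σ) ≠ 0` on `[1 − 1/(A log(N+2)), 1)` — Goldfeld–Hoffstein–Lieman's theorem (no exceptional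
   zero of `L(s, Sym² f)` for `f` not of CM type) in the tree's vocabulary.
3. (`murty_petersson_newform_lower_bound_of_symmFour`) Glue: non-CM with `L_f(1) ≥ 1` is trivial
   (`⟨f,f⟩ = [SL₂(ℤ):Γ₀(N)] L_f(1)/(8π³) ≥ N/(8π³)`, `symmSqL_one`, `le_gamma0Index`); non-CM with
   `L_f(1) < 1` by 2. and the tree's case-A engine `petersson_lower_bound_log_of_symmSqL_zeroFree`
   (`NewformPeterssonSizeSymmSqLZeroFreeProofs`: `⟨f,f⟩ ≥ c₁ N/log(N+2) ≥ (c₁ε/3^ε) N^{1−ε}`); CM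
   with `j ≠ 0` by `exists_petersson_ge_of_hasCM_of_j_ne_zero` (`NewformPeterssonSizeCMReductionProofs`:
   `j = 1728` and the eleven twist classes via Hecke `L`-functions of `ℚ(i)`); `j = 0` by
   `exists_symmSqLOne_ge_of_j_eq_zero` (`NewformSymmSquareJ0Hecke`: Hecke `L`-functions of `ℚ(√−3)`).

Sections `SymmFourGHL` (real-axis analysis, correction factor, the auxiliary function) are the
Literature port of the Summits-side helpers
`Summits/ABC/ABC/Theorems/DefiniteXiPeterssonLowerBoundStubZE{Aux,}.lean` (stub `stub_ZE` of the crux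
`DefiniteXi.PeterssonLowerBound`, stmt-ABC-10870, p103973) and the glue is that of
`Summits/ABC/ABC/Theorems/DefiniteXiPeterssonLowerBound.lean` (`PeterssonLowerBound_of`), statements
and proofs unchanged up to names — reproduced here because `Literature/` may not import `Summits/`
and the discharge of a Literature fact must live next to it.

## References

* [HoffsteinLockhart1994] J. Hoffstein, P. Lockhart, *Coefficients of Maass forms and the Siegel
  zero*, Ann. of Math. 140 (1994) 161–181, Thm. 0.1; Appendix *An effective zero-free region* by
  D. Goldfeld, J. Hoffstein, D. Lieman, pp. 177–181.
* [IwaniecKowalski2004] H. Iwaniec, E. Kowalski, *Analytic Number Theory* (2004), Thm. 5.44,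
  Cor. 5.45, (5.104).
* [MurtyCongruencePrimes1999] M. R. Murty, *Bounds for congruence primes*, Proc. Sympos. Pure
  Math. 66.1 (1999) 177–192, §2 (the printed source of the fact; proof by Hoffstein–Lockhart).
* [Kim2003] H. H. Kim, *Functoriality for the exterior square of GL₄ and the symmetric fourth of
  GL₂*, J. Amer. Math. Soc. 16 (2003), Thm. B (the hypothesis, via `KimSymmetricFourthGL2.lean`).
-/

noncomputable section

open scoped Real Topology
open Set Filter Metric Complex CongruenceSubgroup
open Literature.NumberTheory.LFunctions

namespace Literature.NumberTheory.EllipticCurves.ModularForms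

namespace SymmFourGHL

/-! ### Terms `b · p^{-(k+1)s}` with real `b` -/

/-- At a real point `x`, the term `b · p^{-(k+1)x}` with real `b` is the real number
`b · p^{-(k+1)x}`. [folklore] -/
theorem logEulerTerm_ofReal (b x : ℝ) (p : Nat.Primes) (k : ℕ) :
    ((b : ℝ) : ℂ) * (p : ℂ) ^ (-((k + 1 : ℕ) : ℂ) * (x : ℂ)) =
      ((b * (p : ℝ) ^ (-((k + 1 : ℕ) : ℝ) * x) : ℝ) : ℂ) := by
  rw [Complex.ofReal_mul, Complex.ofReal_cpow (Nat.cast_nonneg _), Complex.ofReal_natCast]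
  congr 2
  push_cast
  ring

/-- `‖b · p^{-(k+1)s}‖ = |b| · p^{-(k+1) Re s}` for real `b`. [folklore] -/
theorem norm_logEulerTerm (b : ℝ) (p : Nat.Primes) (k : ℕ) (s : ℂ) :
    ‖((b : ℝ) : ℂ) * (p : ℂ) ^ (-((k + 1 : ℕ) : ℂ) * s)‖ =
      |b| * (p : ℝ) ^ (-((k + 1 : ℕ) : ℝ) * s.re) := by
  rw [norm_mul, Complex.norm_real, Real.norm_eq_abs, Complex.norm_natCast_cpow_of_pos p.prop.pos]
  congr 2
  simp [Complex.mul_re]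

/-- At a real point the complex and the real terms have the same norm. [folklore] -/
theorem norm_logEulerTerm_ofReal (b x : ℝ) (p : Nat.Primes) (k : ℕ) :
    ‖((b : ℝ) : ℂ) * (p : ℂ) ^ (-((k + 1 : ℕ) : ℂ) * (x : ℂ))‖ =
      ‖b * (p : ℝ) ^ (-((k + 1 : ℕ) : ℝ) * x)‖ := by
  rw [logEulerTerm_ofReal, Complex.norm_real]

/-- **Real points: the complex double series is the real double series**, and absolute
summability of the complex terms gives summability of the real inner series and of the real
outer series of inner sums. [folklore] -/
theorem logEuler_real_summable {b : Nat.Primes → ℕ → ℝ} {x : ℝ}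
    (h1 : ∀ p : Nat.Primes, Summable fun k : ℕ ↦
      ‖((b p k : ℝ) : ℂ) * (p : ℂ) ^ (-((k + 1 : ℕ) : ℂ) * (x : ℂ))‖)
    (h2 : Summable fun p : Nat.Primes ↦ ∑' k : ℕ,
      ‖((b p k : ℝ) : ℂ) * (p : ℂ) ^ (-((k + 1 : ℕ) : ℂ) * (x : ℂ))‖) :
    (∀ p : Nat.Primes, Summable fun k : ℕ ↦ b p k * (p : ℝ) ^ (-((k + 1 : ℕ) : ℝ) * x)) ∧
    (Summable fun p : Nat.Primes ↦ ∑' k : ℕ, b p k * (p : ℝ) ^ (-((k + 1 : ℕ) : ℝ) * x)) ∧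
    ∑' p : Nat.Primes, ∑' k : ℕ, ((b p k : ℝ) : ℂ) * (p : ℂ) ^ (-((k + 1 : ℕ) : ℂ) * (x : ℂ)) =
      ((∑' p : Nat.Primes, ∑' k : ℕ, b p k * (p : ℝ) ^ (-((k + 1 : ℕ) : ℝ) * x) : ℝ) : ℂ) := by
  simp only [norm_logEulerTerm_ofReal] at h1 h2
  refine ⟨fun p ↦ (h1 p).of_norm, h2.of_norm_bounded fun p ↦ norm_tsum_le_tsum_norm (h1 p), ?_⟩
  rw [Complex.ofReal_tsum]
  refine tsum_congr fun p ↦ ?_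
  rw [Complex.ofReal_tsum]
  exact tsum_congr fun k ↦ logEulerTerm_ofReal _ _ _ _

/-! ### The log-Euler series of `ζ` at real points -/

/-- For a prime `p` and real `x ≥ 1`: `0 < p^{-x} ≤ 1/2`. [folklore] -/
theorem prime_rpow_neg_pos_le_half (p : Nat.Primes) {x : ℝ} (hx : 1 ≤ x) :
    0 < (p : ℝ) ^ (-x) ∧ (p : ℝ) ^ (-x) ≤ 1 / 2 := by
  have hp : (2 : ℝ) ≤ p := by exact_mod_cast p.prop.two_le
  have hp0 : (0 : ℝ) < p := by linarith
  refine ⟨Real.rpow_pos_of_pos hp0 _, ?_⟩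
  calc (p : ℝ) ^ (-x) ≤ (2 : ℝ) ^ (-x) := Real.rpow_le_rpow_of_nonpos (by norm_num) hp (by linarith)
    _ ≤ (2 : ℝ) ^ (-1 : ℝ) := Real.rpow_le_rpow_of_exponent_le (by norm_num) (by linarith)
    _ = 1 / 2 := by rw [Real.rpow_neg_one]; norm_num

/-- For `0 ≤ r ≤ 1/2`: `Σ_k r^{k+1}/(k+1)` converges and is at most `Σ_k r^{k+1} = r/(1-r) ≤ 2r`.
[folklore] -/
theorem summable_geometric_div_succ {r : ℝ} (h0 : 0 ≤ r) (h2 : r ≤ 1 / 2) :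
    (Summable fun k : ℕ ↦ r ^ (k + 1) / ((k : ℝ) + 1)) ∧
      ∑' k : ℕ, r ^ (k + 1) / ((k : ℝ) + 1) ≤ 2 * r := by
  have h1 : r < 1 := by linarith
  have hg : HasSum (fun k : ℕ ↦ r ^ (k + 1)) (r * (1 - r)⁻¹) := by
    simpa only [pow_succ'] using (hasSum_geometric_of_lt_one h0 h1).mul_left r
  have hle : ∀ k : ℕ, r ^ (k + 1) / ((k : ℝ) + 1) ≤ r ^ (k + 1) := fun k ↦
    div_le_self (pow_nonneg h0 _) (by linarith [(Nat.cast_nonneg k : (0 : ℝ) ≤ k)])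
  have hnn : ∀ k : ℕ, 0 ≤ r ^ (k + 1) / ((k : ℝ) + 1) := fun k ↦ by positivity
  have hs : Summable fun k : ℕ ↦ r ^ (k + 1) / ((k : ℝ) + 1) :=
    hg.summable.of_nonneg_of_le hnn hle
  refine ⟨hs, ?_⟩
  calc ∑' k : ℕ, r ^ (k + 1) / ((k : ℝ) + 1)
        ≤ ∑' k : ℕ, r ^ (k + 1) := hs.tsum_le_tsum hle hg.summable
    _ = r * (1 - r)⁻¹ := hg.tsum_eq
    _ ≤ 2 * r := by
        rw [← div_eq_mul_inv, div_le_iff₀ (by linarith)]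
        nlinarith

/-- `‖(1/(k+1)) p^{-(k+1)x}‖ = (p^{-x})^{k+1}/(k+1)` at a real point `x`. [folklore] -/
theorem norm_zetaLogTerm (p : Nat.Primes) (k : ℕ) (x : ℝ) :
    ‖(((1 / ((k : ℝ) + 1) : ℝ)) : ℂ) * (p : ℂ) ^ (-((k + 1 : ℕ) : ℂ) * (x : ℂ))‖ =
      ((p : ℝ) ^ (-x)) ^ (k + 1) / ((k : ℝ) + 1) := by
  rw [norm_logEulerTerm, Complex.ofReal_re, abs_of_nonneg (by positivity),
    show -((k + 1 : ℕ) : ℝ) * x = (-x) * ((k + 1 : ℕ) : ℝ) by ring,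
    Real.rpow_mul_natCast (Nat.cast_nonneg _)]
  ring

/-- The Taylor series of the logarithm of an Euler factor of `ζ` at a real point `x > 0`:
`-log(1 - p^{-x}) = Σ_{k ≥ 0} p^{-(k+1)x}/(k+1)`. [folklore] -/
theorem neg_log_one_sub_prime_cpow_eq_tsum (p : Nat.Primes) {x : ℝ} (hx : 0 < x) :
    -Complex.log (1 - (p : ℂ) ^ (-(x : ℂ))) =
      ∑' k : ℕ, (((1 / ((k : ℝ) + 1) : ℝ)) : ℂ) * (p : ℂ) ^ (-((k + 1 : ℕ) : ℂ) * (x : ℂ)) := by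
  have hp1 : (1 : ℝ) < p := by exact_mod_cast p.prop.one_lt
  have hzn : ‖(p : ℂ) ^ (-(x : ℂ))‖ < 1 := by
    rw [Complex.norm_natCast_cpow_of_pos p.prop.pos, Complex.neg_re, Complex.ofReal_re]
    exact Real.rpow_lt_one_of_one_lt_of_neg hp1 (by linarith)
  have h := (hasSum_nat_add_iff' 1).mpr (Complex.hasSum_taylorSeries_neg_log hzn)
  simp only [Finset.range_one, Finset.sum_singleton, pow_zero, Nat.cast_zero, div_zero,
    sub_zero] at h
  rw [← h.tsum_eq]
  refine tsum_congr fun k ↦ ?_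
  rw [← Complex.cpow_nat_mul, show ((k + 1 : ℕ) : ℂ) * -(x : ℂ) = -((k + 1 : ℕ) : ℂ) * (x : ℂ) by ring]
  push_cast
  ring

/-- **The log-Euler series of `ζ` at a real point `x > 1`**, in the prime-power format with
coefficients `1/(k+1)`: `ζ(x) = exp(Σ_p Σ_k (1/(k+1)) p^{-(k+1)x})`, the terms being absolutely
summable (inner series for each `p`, and the outer series of the inner sums of norms).
(Mathlib's `riemannZeta_eulerProduct_exp_log` and the Taylor series of `-log(1 - z)`; the
majorant is the geometric series, `p^{-x} ≤ 1/2`.) [folklore] -/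
theorem riemannZeta_ofReal_eq_exp_logEuler {x : ℝ} (hx : 1 < x) :
    (∀ p : Nat.Primes, Summable fun k : ℕ ↦
      ‖(((1 / ((k : ℝ) + 1) : ℝ)) : ℂ) * (p : ℂ) ^ (-((k + 1 : ℕ) : ℂ) * (x : ℂ))‖) ∧
    (Summable fun p : Nat.Primes ↦ ∑' k : ℕ,
      ‖(((1 / ((k : ℝ) + 1) : ℝ)) : ℂ) * (p : ℂ) ^ (-((k + 1 : ℕ) : ℂ) * (x : ℂ))‖) ∧
    riemannZeta x = Complex.exp (∑' p : Nat.Primes, ∑' k : ℕ,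
      (((1 / ((k : ℝ) + 1) : ℝ)) : ℂ) * (p : ℂ) ^ (-((k + 1 : ℕ) : ℂ) * (x : ℂ))) := by
  have hgeo := fun p : Nat.Primes ↦ summable_geometric_div_succ
    (prime_rpow_neg_pos_le_half p hx.le).1.le (prime_rpow_neg_pos_le_half p hx.le).2
  simp only [norm_zetaLogTerm]
  refine ⟨fun p ↦ (hgeo p).1, ?_, ?_⟩
  · exact ((Nat.Primes.summable_rpow.mpr (by linarith : -x < -1)).mul_left 2).of_nonneg_of_le
      (fun p ↦ tsum_nonneg fun k ↦ by positivity) fun p ↦ (hgeo p).2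
  · rw [← riemannZeta_eulerProduct_exp_log (by simpa using hx : 1 < (x : ℂ).re)]
    congr 1
    exact tsum_congr fun p ↦ neg_log_one_sub_prime_cpow_eq_tsum p (by linarith)

/-! ### Real double series: linear combinations and antitonicity -/

/-- The linear combination `2Σ₀ + 3Σ₂ + Σ₄` of three real double series, each with summable
inner series and summable outer series of inner sums. [folklore] -/
theorem tsum_tsum_comb {ι κ : Type*} {F₀ F₂ F₄ : ι → κ → ℝ}
    (h₀ : ∀ i, Summable (F₀ i)) (h₀' : Summable fun i ↦ ∑' k, F₀ i k)
    (h₂ : ∀ i, Summable (F₂ i)) (h₂' : Summable fun i ↦ ∑' k, F₂ i k)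
    (h₄ : ∀ i, Summable (F₄ i)) (h₄' : Summable fun i ↦ ∑' k, F₄ i k) :
    (∀ i, Summable fun k ↦ 2 * F₀ i k + 3 * F₂ i k + F₄ i k) ∧
    (Summable fun i ↦ ∑' k, (2 * F₀ i k + 3 * F₂ i k + F₄ i k)) ∧
    ∑' i, ∑' k, (2 * F₀ i k + 3 * F₂ i k + F₄ i k) =
      2 * ∑' i, ∑' k, F₀ i k + 3 * ∑' i, ∑' k, F₂ i k + ∑' i, ∑' k, F₄ i k := by
  have hin : ∀ i, Summable fun k ↦ 2 * F₀ i k + 3 * F₂ i k + F₄ i k :=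
    fun i ↦ (((h₀ i).mul_left 2).add ((h₂ i).mul_left 3)).add (h₄ i)
  have hin_eq : ∀ i, ∑' k, (2 * F₀ i k + 3 * F₂ i k + F₄ i k) =
      2 * ∑' k, F₀ i k + 3 * ∑' k, F₂ i k + ∑' k, F₄ i k := fun i ↦ by
    rw [(((h₀ i).mul_left 2).add ((h₂ i).mul_left 3)).tsum_add (h₄ i),
      ((h₀ i).mul_left 2).tsum_add ((h₂ i).mul_left 3), tsum_mul_left, tsum_mul_left]
  refine ⟨hin, ?_, ?_⟩
  · simp only [hin_eq]
    exact ((h₀'.mul_left 2).add (h₂'.mul_left 3)).add h₄'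
  · simp only [hin_eq]
    rw [((h₀'.mul_left 2).add (h₂'.mul_left 3)).tsum_add h₄',
      (h₀'.mul_left 2).tsum_add (h₂'.mul_left 3), tsum_mul_left, tsum_mul_left]

/-- **Antitonicity** of a real prime-power series with non-negative coefficients:
`x ≤ y ⟹ Σ_p Σ_k c(p,k) p^{-(k+1)y} ≤ Σ_p Σ_k c(p,k) p^{-(k+1)x}` (termwise, `p ≥ 2`), given
summability at `x` (summability at `y` follows by comparison). [folklore] -/
theorem logEuler_real_antitone {c : Nat.Primes → ℕ → ℝ} (hc : ∀ p k, 0 ≤ c p k) {x y : ℝ}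
    (hxy : x ≤ y)
    (h1 : ∀ p : Nat.Primes, Summable fun k : ℕ ↦ c p k * (p : ℝ) ^ (-((k + 1 : ℕ) : ℝ) * x))
    (h2 : Summable fun p : Nat.Primes ↦ ∑' k : ℕ, c p k * (p : ℝ) ^ (-((k + 1 : ℕ) : ℝ) * x)) :
    ∑' p : Nat.Primes, ∑' k : ℕ, c p k * (p : ℝ) ^ (-((k + 1 : ℕ) : ℝ) * y) ≤
      ∑' p : Nat.Primes, ∑' k : ℕ, c p k * (p : ℝ) ^ (-((k + 1 : ℕ) : ℝ) * x) := by
  have hnn : ∀ (z : ℝ) (p : Nat.Primes) (k : ℕ),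
      0 ≤ c p k * (p : ℝ) ^ (-((k + 1 : ℕ) : ℝ) * z) :=
    fun z p k ↦ mul_nonneg (hc p k) (Real.rpow_nonneg (Nat.cast_nonneg _) _)
  have hle : ∀ (p : Nat.Primes) (k : ℕ), c p k * (p : ℝ) ^ (-((k + 1 : ℕ) : ℝ) * y) ≤
      c p k * (p : ℝ) ^ (-((k + 1 : ℕ) : ℝ) * x) := fun p k ↦ by
    refine mul_le_mul_of_nonneg_left (Real.rpow_le_rpow_of_exponent_le ?_ ?_) (hc p k)
    · exact_mod_cast p.prop.one_lt.le
    · have : (0 : ℝ) ≤ ((k + 1 : ℕ) : ℝ) := Nat.cast_nonneg _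
      nlinarith
  have h1y : ∀ p : Nat.Primes, Summable fun k : ℕ ↦ c p k * (p : ℝ) ^ (-((k + 1 : ℕ) : ℝ) * y) :=
    fun p ↦ (h1 p).of_nonneg_of_le (hnn y p) (hle p)
  have hin : ∀ p : Nat.Primes, ∑' k : ℕ, c p k * (p : ℝ) ^ (-((k + 1 : ℕ) : ℝ) * y) ≤
      ∑' k : ℕ, c p k * (p : ℝ) ^ (-((k + 1 : ℕ) : ℝ) * x) :=
    fun p ↦ (h1y p).tsum_le_tsum (hle p) (h1 p)
  have h2y : Summable fun p : Nat.Primes ↦ ∑' k : ℕ, c p k * (p : ℝ) ^ (-((k + 1 : ℕ) : ℝ) * y) :=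
    h2.of_nonneg_of_le (fun p ↦ tsum_nonneg (hnn y p)) hin
  exact h2y.tsum_le_tsum hin h2

/-! ### The correction factor `∏_{p ∣ N}(1 + p^{-s})` -/

/-- `s ↦ ∏_{p ∣ N}(1 + p^{-s})` is entire. [folklore] -/
theorem differentiable_corr (N : ℕ) :
    Differentiable ℂ fun s : ℂ ↦ ∏ p ∈ N.primeFactors, (1 + (p : ℂ) ^ (-s)) := by
  refine Differentiable.fun_finsetProd fun p hp ↦ ?_
  have hp : (p : ℂ) ≠ 0 := by exact_mod_cast (Nat.prime_of_mem_primeFactors hp).ne_zero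
  intro s
  exact (differentiableAt_id.neg.const_cpow (Or.inl hp)).const_add 1

/-- **`|∏_{p ∣ N}(1 + p^{-s})| ≤ N` for `Re s ≥ 0`** (each factor has modulus `≤ 2`, and
`2^{ω(N)} ≤ ∏_{p ∣ N} p ≤ N`; cf. `Literature.NumberTheory.Sieve.GPY.two_pow_card_primeFactors_le`).
[folklore] -/
theorem norm_corr_le {N : ℕ} (hN : N ≠ 0) {s : ℂ} (hs : 0 ≤ s.re) :
    ‖∏ p ∈ N.primeFactors, (1 + (p : ℂ) ^ (-s))‖ ≤ N := by
  have h2 : ∀ p ∈ N.primeFactors, ‖1 + (p : ℂ) ^ (-s)‖ ≤ 2 := fun p hp ↦ by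
    have hp := Nat.prime_of_mem_primeFactors hp
    calc ‖1 + (p : ℂ) ^ (-s)‖ ≤ ‖(1 : ℂ)‖ + ‖(p : ℂ) ^ (-s)‖ := norm_add_le _ _
      _ ≤ 1 + 1 := by
          rw [norm_one, Complex.norm_natCast_cpow_of_pos hp.pos, Complex.neg_re]
          gcongr
          exact Real.rpow_le_one_of_one_le_of_nonpos (by exact_mod_cast hp.one_lt.le) (by linarith)
      _ = 2 := by norm_num
  calc ‖∏ p ∈ N.primeFactors, (1 + (p : ℂ) ^ (-s))‖
        = ∏ p ∈ N.primeFactors, ‖1 + (p : ℂ) ^ (-s)‖ := norm_prod _ _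
    _ ≤ ∏ _p ∈ N.primeFactors, (2 : ℝ) := Finset.prod_le_prod (fun _ _ ↦ norm_nonneg _) h2
    _ = ((2 ^ N.primeFactors.card : ℕ) : ℝ) := by rw [Finset.prod_const]; push_cast; rfl
    _ ≤ ((∏ p ∈ N.primeFactors, p : ℕ) : ℝ) := by
        exact_mod_cast Finset.pow_card_le_prod _ _ 2 fun _ hp ↦
          (Nat.prime_of_mem_primeFactors hp).two_le
    _ ≤ N := by
        exact_mod_cast Nat.le_of_dvd (Nat.pos_of_ne_zero hN) (Nat.prod_primeFactors_dvd N)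

/-! ### The sign of `Re Z'/Z` on the real axis -/

/-- If `Z` is complex-differentiable at the real point `σ > 1` and coincides on `(1, ∞)` with a
real, positive-at-`σ`, antitone function `g`, then `Re (Z'(σ)/Z(σ)) ≤ 0`. [folklore] -/
theorem re_deriv_div_nonpos_of_antitoneOn {Z : ℂ → ℂ} {g : ℝ → ℝ} {σ : ℝ} (hσ : 1 < σ)
    (hZ : DifferentiableAt ℂ Z σ) (hg : AntitoneOn g (Ioi 1)) (hpos : 0 < g σ)
    (heq : ∀ y : ℝ, 1 < y → Z y = (g y : ℂ)) :
    (deriv Z σ / Z σ).re ≤ 0 := by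
  have h2 : HasDerivAt (fun y : ℝ ↦ (Z y).re) (deriv Z σ).re σ := hZ.hasDerivAt.real_of_complex
  have h3 : AntitoneOn (fun y : ℝ ↦ (Z y).re) (Ioi 1) := by
    intro a ha b hb hab
    simp only [heq a ha, heq b hb, Complex.ofReal_re]
    exact hg ha hb hab
  have h4 : AccPt σ (𝓟 (Ioi 1)) := by
    rw [accPt_principal_iff_nhdsWithin]
    have hle : (𝓝[>] σ) ≤ 𝓝[Ioi 1 \ {σ}] σ :=
      nhdsWithin_mono _ fun y hy ↦ ⟨lt_trans hσ hy, ne_of_gt hy⟩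
    exact (inferInstance : (𝓝[>] σ).NeBot).mono hle
  have h5 : (deriv Z σ).re ≤ 0 := h2.hasDerivWithinAt.nonpos_of_antitoneOn h4 h3
  rw [heq σ hσ, Complex.div_ofReal_re]
  exact div_nonpos_of_nonpos_of_nonneg h5 hpos.le

/-- If `Z(σ) = g(σ)` with `g(σ) ≥ 1` real then `|Z(σ)| ≥ 1`. [folklore] -/
theorem one_le_norm_of_eq_ofReal {Z : ℂ → ℂ} {g : ℝ → ℝ} {σ : ℝ} (h1 : 1 ≤ g σ)
    (heq : Z σ = (g σ : ℂ)) : 1 ≤ ‖Z σ‖ := by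
  rw [heq, Complex.norm_real, Real.norm_eq_abs]
  exact h1.trans (le_abs_self _)

/-! ### The real axis: `ζ² L_♭³ L₄ = exp(T)` with `T ≥ 0` antitone -/

/-- **The auxiliary function on the real axis.** Let `b₂, b₄` be real coefficient systems with
`2/(k+1) + 3 b₂(p,k) + b₄(p,k) ≥ 0`, and let `L_♭`, `L₄` satisfy, at every real `y > 1`,
`L_♭(y) = exp(Σ_p Σ_k b₂(p,k) p^{-(k+1)y})`, `L₄(y) = exp(Σ_p Σ_k b₄(p,k) p^{-(k+1)y})` with
absolutely convergent series. Then there is a real function `T`, antitone and non-negative on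
`(1, ∞)`, with `ζ(y)² L_♭(y)³ L₄(y) = exp(T(y))` for all real `y > 1` — namely
`T(y) = Σ_p Σ_k (2/(k+1) + 3b₂ + b₄) p^{-(k+1)y}`, using `ζ(y) = exp(Σ_p Σ_k p^{-(k+1)y}/(k+1))`.
[cite: HoffsteinLockhart1994, Appendix (Goldfeld–Hoffstein–Lieman)] -/
theorem exists_realAxis_exp {b₂ b₄ : Nat.Primes → ℕ → ℝ}
    (hc : ∀ (p : Nat.Primes) (k : ℕ), 0 ≤ 2 * (1 / ((k : ℝ) + 1)) + 3 * b₂ p k + b₄ p k)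
    {Lb L₄ : ℂ → ℂ}
    (h₂ : ∀ y : ℝ, 1 < y →
      (∀ p : Nat.Primes, Summable fun k : ℕ ↦
        ‖((b₂ p k : ℝ) : ℂ) * (p : ℂ) ^ (-((k + 1 : ℕ) : ℂ) * (y : ℂ))‖) ∧
      (Summable fun p : Nat.Primes ↦ ∑' k : ℕ,
        ‖((b₂ p k : ℝ) : ℂ) * (p : ℂ) ^ (-((k + 1 : ℕ) : ℂ) * (y : ℂ))‖) ∧
      Lb y = Complex.exp (∑' p : Nat.Primes, ∑' k : ℕ,
        ((b₂ p k : ℝ) : ℂ) * (p : ℂ) ^ (-((k + 1 : ℕ) : ℂ) * (y : ℂ))))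
    (h₄ : ∀ y : ℝ, 1 < y →
      (∀ p : Nat.Primes, Summable fun k : ℕ ↦
        ‖((b₄ p k : ℝ) : ℂ) * (p : ℂ) ^ (-((k + 1 : ℕ) : ℂ) * (y : ℂ))‖) ∧
      (Summable fun p : Nat.Primes ↦ ∑' k : ℕ,
        ‖((b₄ p k : ℝ) : ℂ) * (p : ℂ) ^ (-((k + 1 : ℕ) : ℂ) * (y : ℂ))‖) ∧
      L₄ y = Complex.exp (∑' p : Nat.Primes, ∑' k : ℕ,
        ((b₄ p k : ℝ) : ℂ) * (p : ℂ) ^ (-((k + 1 : ℕ) : ℂ) * (y : ℂ)))) :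
    ∃ T : ℝ → ℝ, AntitoneOn T (Ioi 1) ∧ (∀ y : ℝ, 1 < y → 0 ≤ T y) ∧
      ∀ y : ℝ, 1 < y → riemannZeta y ^ 2 * Lb y ^ 3 * L₄ y = ((Real.exp (T y) : ℝ) : ℂ) := by
  -- the combined coefficients
  set c : Nat.Primes → ℕ → ℝ := fun p k ↦ 2 * (1 / ((k : ℝ) + 1)) + 3 * b₂ p k + b₄ p k
    with hc_def
  have hc' : ∀ (p : Nat.Primes) (k : ℕ), 0 ≤ c p k := hc
  -- summability of the combined real series at every `y > 1`, and the value of `ζ² L_♭³ L₄`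
  have key : ∀ y : ℝ, 1 < y →
      (∀ p : Nat.Primes, Summable fun k : ℕ ↦ c p k * (p : ℝ) ^ (-((k + 1 : ℕ) : ℝ) * y)) ∧
      (Summable fun p : Nat.Primes ↦ ∑' k : ℕ, c p k * (p : ℝ) ^ (-((k + 1 : ℕ) : ℝ) * y)) ∧
      riemannZeta y ^ 2 * Lb y ^ 3 * L₄ y = Complex.exp
        ((∑' p : Nat.Primes, ∑' k : ℕ, c p k * (p : ℝ) ^ (-((k + 1 : ℕ) : ℝ) * y) : ℝ) : ℂ) := by
    intro y hy
    obtain ⟨hz1, hz2, hz3⟩ := riemannZeta_ofReal_eq_exp_logEuler hy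
    obtain ⟨h21, h22, h23⟩ := h₂ y hy
    obtain ⟨h41, h42, h43⟩ := h₄ y hy
    obtain ⟨hr01, hr02, hr03⟩ := logEuler_real_summable hz1 hz2
    obtain ⟨hr21, hr22, hr23⟩ := logEuler_real_summable h21 h22
    obtain ⟨hr41, hr42, hr43⟩ := logEuler_real_summable h41 h42
    obtain ⟨hs1, hs2, hs3⟩ := tsum_tsum_comb hr01 hr02 hr21 hr22 hr41 hr42
    have e : ∀ (p : Nat.Primes) (k : ℕ), c p k * (p : ℝ) ^ (-((k + 1 : ℕ) : ℝ) * y) =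
        2 * ((1 / ((k : ℝ) + 1)) * (p : ℝ) ^ (-((k + 1 : ℕ) : ℝ) * y)) +
        3 * (b₂ p k * (p : ℝ) ^ (-((k + 1 : ℕ) : ℝ) * y)) +
        b₄ p k * (p : ℝ) ^ (-((k + 1 : ℕ) : ℝ) * y) := by
      intro p k; simp only [hc_def]; ring
    simp only [e]
    refine ⟨hs1, hs2, ?_⟩
    rw [hs3, hz3, h23, h43, hr03, hr23, hr43, ← Complex.exp_nat_mul, ← Complex.exp_nat_mul,
      ← Complex.exp_add, ← Complex.exp_add]
    push_cast
    ring_nf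
  refine ⟨fun y ↦ ∑' p : Nat.Primes, ∑' k : ℕ, c p k * (p : ℝ) ^ (-((k + 1 : ℕ) : ℝ) * y),
    ?_, ?_, ?_⟩
  · intro x hx y _ hxy
    exact logEuler_real_antitone hc' hxy (key x hx).1 (key x hx).2.1
  · intro y _
    exact tsum_nonneg fun p ↦ tsum_nonneg fun k ↦
      mul_nonneg (hc' p k) (Real.rpow_nonneg (Nat.cast_nonneg _) _)
  · intro y hy
    rw [(key y hy).2.2, Complex.ofReal_exp]


/-- **The GHL auxiliary function, abstract coefficients.** The construction of `exists_GHL_auxiliary_newform` for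
arbitrary real coefficient systems `b₂` (log-coefficients of `L_f · corr`) and `b₄` (of `L₄`)
subject only to the positivity `2/(k+1) + 3 b₂(p,k) + b₄(p,k) ≥ 0`: with the Siegel radius `r`
(`exists_siegel_radius`) and the disc bound `‖L_f‖ ≤ B₀ N¹⁵ max(1, L_f(1))`
(`exists_norm_symmSqL_le`), given `C ≥ 1`, `K ≥ 0` take `A = B₁/log 2 + 48 + K`,
`B₁ = max(1, log(441 B₀³ C))`; for a real zero `β ∈ (1 - r, 1)` of `L_f` put
`L_♭ = L_f · ∏_{p∣N}(1 + p^{-s})`, `D = dslope L_♭ β` (so `(s - β) D = L_♭`),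
`G = ζ₁² D³ L₄`, `Z = ζ² L_♭³ L₄`, `B = B₁ + (48 + K) log(N + 2)`. On `|s - 1| < r`:
`|ζ₁| ≤ 21`, `|L_f| ≤ B₀ N¹⁵`, `|corr| ≤ N`, `|L₄| ≤ C N^K` give `|(s-β)³G| ≤ e^B`; zeros of `G`
with `Re s > 1` are impossible (`ζ₁ ≠ 0`, `L_♭ = exp ≠ 0`, `L₄ = exp ≠ 0`); `ζ₁ = (s-1)ζ` gives the
identity; on the real axis `Z = exp(T)` with `T ≥ 0` antitone (`exists_realAxis_exp`), whence
`|Z| ≥ 1` and `Re Z'/Z ≤ 0`. [cite: HoffsteinLockhart1994, Appendix (Goldfeld–Hoffstein–Lieman)] -/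
theorem exists_GHL_auxiliary :
    ∃ r : ℝ, 0 < r ∧ r ≤ 1 / 4 ∧ (∀ s ∈ ball (2 : ℂ) (1 + 2 * r), 0 < s.re ∧ riemannZeta₁ s ≠ 0) ∧
      ∀ (C K : ℝ), 1 ≤ C → 0 ≤ K → ∃ A : ℝ, 0 < A ∧
        ∀ (N : ℕ) [NeZero N] (f : CuspForm (Gamma0 N) 2) (b₂ b₄ : Nat.Primes → ℕ → ℝ),
          (∀ (p : Nat.Primes) (k : ℕ), 0 ≤ 2 * (1 / ((k : ℝ) + 1)) + 3 * b₂ p k + b₄ p k) →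
          (∀ s : ℂ, 1 < s.re →
            (∀ p : Nat.Primes, Summable fun k : ℕ ↦
              ‖((b₂ p k : ℝ) : ℂ) * (p : ℂ) ^ (-((k + 1 : ℕ) : ℂ) * s)‖) ∧
            (Summable fun p : Nat.Primes ↦ ∑' k : ℕ,
              ‖((b₂ p k : ℝ) : ℂ) * (p : ℂ) ^ (-((k + 1 : ℕ) : ℂ) * s)‖) ∧
            symmSqL N f s * ∏ p ∈ N.primeFactors, (1 + (p : ℂ) ^ (-s)) =
              Complex.exp (∑' p : Nat.Primes, ∑' k : ℕ,
                ((b₂ p k : ℝ) : ℂ) * (p : ℂ) ^ (-((k + 1 : ℕ) : ℂ) * s))) →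
          ∀ (L₄ : ℂ → ℂ), Differentiable ℂ L₄ →
            (∀ s : ℂ, 1 < s.re →
              (∀ p : Nat.Primes, Summable fun k : ℕ ↦
                ‖((b₄ p k : ℝ) : ℂ) * (p : ℂ) ^ (-((k + 1 : ℕ) : ℂ) * s)‖) ∧
              (Summable fun p : Nat.Primes ↦ ∑' k : ℕ,
                ‖((b₄ p k : ℝ) : ℂ) * (p : ℂ) ^ (-((k + 1 : ℕ) : ℂ) * s)‖) ∧
              L₄ s = Complex.exp (∑' p : Nat.Primes, ∑' k : ℕ,
                ((b₄ p k : ℝ) : ℂ) * (p : ℂ) ^ (-((k + 1 : ℕ) : ℂ) * s))) →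
            (∀ s ∈ closedBall (2 : ℂ) (3 / 2), ‖L₄ s‖ ≤ C * (N : ℝ) ^ K) →
            (symmSqL N f 1).re < 1 →
            ∀ β : ℝ, 1 - r < β → β < 1 → symmSqL N f β = 0 →
              ∃ (G Z : ℂ → ℂ) (B : ℝ), 1 ≤ B ∧ B ≤ A * Real.log (N + 2) ∧
                DifferentiableOn ℂ G (ball (1 : ℂ) r) ∧
                (∀ s ∈ ball (1 : ℂ) r, ‖(s - β) ^ (2 + 1) * G s‖ ≤ Real.exp B) ∧
                (∀ s ∈ ball (1 : ℂ) r, G s = 0 → s.re ≤ 1) ∧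
                (∀ s ∈ ball (1 : ℂ) r, s ≠ 1 → (s - β) ^ (2 + 1) * G s = (s - 1) ^ 2 * Z s) ∧
                (∀ σ : ℝ, 1 < σ → σ < 1 + r → 1 ≤ ‖Z σ‖) ∧
                (∀ σ : ℝ, 1 < σ → σ < 1 + r → (deriv Z σ / Z σ).re ≤ 0) := by
  obtain ⟨r, hr0, hr4, hr⟩ := exists_siegel_radius
  obtain ⟨B₀, hB₀, hbd⟩ := exists_norm_symmSqL_le hr0 hr4 hr
  refine ⟨r, hr0, hr4, hr, fun C K hC hK ↦ ?_⟩
  -- the constants `B₁ = max(1, log(441 B₀³ C))`, `A = B₁/log 2 + 48 + K`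
  set B₁ : ℝ := max 1 (Real.log (441 * B₀ ^ 3 * C)) with hB₁
  have hB₁1 : 1 ≤ B₁ := le_max_left _ _
  have hlog2 : 0 < Real.log 2 := Real.log_pos (by norm_num)
  have hexpB₁ : 441 * B₀ ^ 3 * C ≤ Real.exp B₁ :=
    calc 441 * B₀ ^ 3 * C = Real.exp (Real.log (441 * B₀ ^ 3 * C)) :=
          (Real.exp_log (by positivity)).symm
      _ ≤ Real.exp B₁ := Real.exp_le_exp.mpr (le_max_right _ _)
  refine ⟨B₁ / Real.log 2 + 48 + K, by positivity, ?_⟩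
  intro N _ f b₂ b₄ hc hE L₄ hL₄d hL₄E hL₄b hL1 β hβ1 hβ2 hβ0
  have hN0 : N ≠ 0 := NeZero.ne N
  have hN0' : (0 : ℝ) ≤ N := Nat.cast_nonneg N
  have hlogN : Real.log 2 ≤ Real.log (N + 2) := Real.log_le_log (by norm_num) (by linarith)
  have hlogN0 : 0 < Real.log (N + 2) := by linarith
  -- geometry: `ball 1 r ⊆ ball 2 (1 + 2r)`, `⊆ closedBall 2 (1 + r) ⊆ closedBall 2 (3/2)`
  have hd12 : dist (1 : ℂ) 2 = 1 := by
    rw [dist_eq_norm, show (1 : ℂ) - 2 = -1 by norm_num, norm_neg, norm_one]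
  have hsub2 : ball (1 : ℂ) r ⊆ ball (2 : ℂ) (1 + 2 * r) := fun s hs ↦ by
    rw [mem_ball] at hs ⊢
    linarith [dist_triangle s 1 2]
  have hsubc : ball (1 : ℂ) r ⊆ closedBall (2 : ℂ) (1 + r) := fun s hs ↦ by
    rw [mem_ball] at hs
    rw [mem_closedBall]
    linarith [dist_triangle s 1 2]
  have hsub32 : ball (1 : ℂ) r ⊆ closedBall (2 : ℂ) (3 / 2) := fun s hs ↦
    closedBall_subset_closedBall (by linarith) (hsubc hs)
  have hre : ∀ s ∈ ball (1 : ℂ) r, 1 - r < s.re := fun s hs ↦ by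
    rw [mem_ball, dist_eq_norm] at hs
    have h := abs_re_le_norm (s - 1)
    rw [sub_re, Complex.one_re] at h
    have := neg_abs_le (s.re - 1)
    linarith
  have hβmem : (β : ℂ) ∈ ball (1 : ℂ) r := by
    rw [mem_ball, dist_eq_norm, ← Complex.ofReal_one, ← Complex.ofReal_sub, Complex.norm_real,
      Real.norm_eq_abs, abs_lt]
    constructor <;> linarith
  -- the functions `L_♭ = L_f · corr`, `D = dslope L_♭ β`, `G = ζ₁² D³ L₄`, `Z = ζ² L_♭³ L₄`
  set corr : ℂ → ℂ := fun s ↦ ∏ p ∈ N.primeFactors, (1 + (p : ℂ) ^ (-s)) with hcorr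
  set Lb : ℂ → ℂ := fun s ↦ symmSqL N f s * corr s with hLb
  set D : ℂ → ℂ := dslope Lb β with hD
  have hLbβ : Lb β = 0 := by simp [hLb, hβ0]
  have hDs : ∀ s : ℂ, (s - β) * D s = Lb s := fun s ↦ by
    have h := sub_smul_dslope Lb (β : ℂ) s
    rwa [smul_eq_mul, hLbβ, sub_zero] at h
  have hLbd : DifferentiableOn ℂ Lb (ball (1 : ℂ) r) :=
    ((differentiableOn_symmSqL_ball f hr).mul (differentiable_corr N).differentiableOn).mono hsub2
  have hDd : DifferentiableOn ℂ D (ball (1 : ℂ) r) :=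
    (differentiableOn_dslope (isOpen_ball.mem_nhds hβmem)).mpr hLbd
  -- the real axis: `ζ² L_♭³ L₄ = exp(T)`, `T ≥ 0` antitone on `(1, ∞)`
  obtain ⟨T, hTanti, hT0, hTeq⟩ := exists_realAxis_exp hc (Lb := Lb) (L₄ := L₄)
    (fun y hy ↦ hE y (by simpa using hy)) (fun y hy ↦ hL₄E y (by simpa using hy))
  set G : ℂ → ℂ := fun s ↦ riemannZeta₁ s ^ 2 * D s ^ 3 * L₄ s with hG
  set Z : ℂ → ℂ := fun s ↦ riemannZeta s ^ 2 * Lb s ^ 3 * L₄ s with hZ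
  set B : ℝ := B₁ + (48 + K) * Real.log (N + 2) with hB
  refine ⟨G, Z, B, ?_, ?_, ?_, ?_, ?_, ?_, ?_, ?_⟩
  · -- `1 ≤ B`
    have : 0 ≤ (48 + K) * Real.log (N + 2) := by positivity
    linarith
  · -- `B ≤ A log(N + 2)`
    have h1 : B₁ ≤ B₁ / Real.log 2 * Real.log (N + 2) :=
      calc B₁ = B₁ / Real.log 2 * Real.log 2 := by field_simp
        _ ≤ B₁ / Real.log 2 * Real.log (N + 2) := mul_le_mul_of_nonneg_left hlogN (by positivity)
    calc B = B₁ + (48 + K) * Real.log (N + 2) := rfl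
      _ ≤ B₁ / Real.log 2 * Real.log (N + 2) + (48 + K) * Real.log (N + 2) := by linarith
      _ = (B₁ / Real.log 2 + 48 + K) * Real.log (N + 2) := by ring
  · -- holomorphy of `G` on the ball
    exact ((differentiable_riemannZeta₁.differentiableOn.pow 2).mul (hDd.pow 3)).mul
      hL₄d.differentiableOn
  · -- the bound `|(s - β)³ G(s)| ≤ e^B`
    intro s hs
    have hsc := hsubc hs
    have hs32 := hsub32 hs
    have hres : 0 ≤ s.re := by linarith [hre s hs]
    have e : (s - β) ^ (2 + 1) * G s = riemannZeta₁ s ^ 2 * Lb s ^ 3 * L₄ s := by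
      rw [← hDs s]
      simp only [hG]
      ring
    have h1 : ‖riemannZeta₁ s‖ ≤ 21 := EstermannDisc.norm_riemannZeta₁_le_of_mem_closedBall hs32
    have h2 : ‖Lb s‖ ≤ B₀ * N ^ 16 := by
      have h21 : ‖symmSqL N f s‖ ≤ B₀ * N ^ 15 := by
        have := hbd N f s hsc
        rwa [max_eq_left hL1.le, mul_one] at this
      have h22 : ‖corr s‖ ≤ N := norm_corr_le hN0 hres
      calc ‖Lb s‖ = ‖symmSqL N f s‖ * ‖corr s‖ := norm_mul _ _
        _ ≤ B₀ * N ^ 15 * N := mul_le_mul h21 h22 (norm_nonneg _) (by positivity)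
        _ = B₀ * N ^ 16 := by ring
    have h3 : ‖L₄ s‖ ≤ C * N ^ K := hL₄b s hs32
    have hpow : (N : ℝ) ^ 48 * (N : ℝ) ^ K ≤ (N + 2 : ℝ) ^ (48 + K) := by
      rw [Real.rpow_add (by linarith : (0 : ℝ) < N + 2), ← Real.rpow_natCast]
      push_cast
      gcongr <;> linarith
    rw [e, norm_mul, norm_mul, norm_pow, norm_pow]
    calc ‖riemannZeta₁ s‖ ^ 2 * ‖Lb s‖ ^ 3 * ‖L₄ s‖
          ≤ 21 ^ 2 * (B₀ * N ^ 16) ^ 3 * (C * N ^ K) := by gcongr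
      _ = (441 * B₀ ^ 3 * C) * ((N : ℝ) ^ 48 * N ^ K) := by ring
      _ ≤ Real.exp B₁ * (N + 2 : ℝ) ^ (48 + K) :=
          mul_le_mul hexpB₁ hpow (by positivity) (by positivity)
      _ = Real.exp B := by
          rw [hB, Real.exp_add, mul_comm (48 + K), Real.rpow_def_of_pos (by linarith)]
  · -- zeros of `G` in the ball have `Re s ≤ 1`
    intro s _ hGs
    by_contra h
    push Not at h
    have hζ : riemannZeta₁ s ≠ 0 := riemannZeta₁_ne_zero_of_one_le_re' h.le
    have hLbs : Lb s ≠ 0 := by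
      show symmSqL N f s * ∏ p ∈ N.primeFactors, (1 + (p : ℂ) ^ (-s)) ≠ 0
      rw [(hE s h).2.2]
      exact Complex.exp_ne_zero _
    have hDs0 : D s ≠ 0 := by
      intro h0
      have := hDs s
      rw [h0, mul_zero] at this
      exact hLbs this.symm
    have hL₄s : L₄ s ≠ 0 := by
      rw [(hL₄E s h).2.2]
      exact Complex.exp_ne_zero _
    exact (mul_ne_zero (mul_ne_zero (pow_ne_zero _ hζ) (pow_ne_zero _ hDs0)) hL₄s) hGs
  · -- the identity `(s - β)³ G = (s - 1)² Z` off `s = 1`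
    intro s _ hs1
    have hζ₁ : riemannZeta₁ s = (s - 1) * riemannZeta s := by
      rw [riemannZeta_eq_inv_sub_mul hs1, ← mul_assoc, mul_inv_cancel₀ (sub_ne_zero.mpr hs1),
        one_mul]
    calc (s - β) ^ (2 + 1) * G s = riemannZeta₁ s ^ 2 * ((s - β) * D s) ^ 3 * L₄ s := by
          simp only [hG]; ring
      _ = ((s - 1) * riemannZeta s) ^ 2 * Lb s ^ 3 * L₄ s := by rw [hDs, hζ₁]
      _ = (s - 1) ^ 2 * Z s := by simp only [hZ]; ring
  · -- `|Z(σ)| ≥ 1` on `(1, 1 + r)`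
    intro σ h1 _
    exact one_le_norm_of_eq_ofReal (g := fun y ↦ Real.exp (T y))
      (Real.one_le_exp_iff.mpr (hT0 σ h1)) (hTeq σ h1)
  · -- `Re Z'/Z(σ) ≤ 0` on `(1, 1 + r)`
    intro σ h1 h2
    have hσmem : (σ : ℂ) ∈ ball (2 : ℂ) (1 + 2 * r) :=
      ofReal_mem_siegel_ball (by linarith) (by linarith)
    have hσ1 : (σ : ℂ) ≠ 1 := by
      intro h
      have := congrArg Complex.re h
      simp at this
      linarith
    have hLbσ : DifferentiableAt ℂ Lb σ :=
      ((differentiableOn_symmSqL_ball f hr).differentiableAt (isOpen_ball.mem_nhds hσmem)).mul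
        (differentiable_corr N _)
    have hZd : DifferentiableAt ℂ Z σ :=
      (((differentiableAt_riemannZeta hσ1).pow 2).mul (hLbσ.pow 3)).mul (hL₄d _)
    exact re_deriv_div_nonpos_of_antitoneOn (g := fun y ↦ Real.exp (T y)) h1 hZd
      (fun a ha b hb hab ↦ Real.exp_le_exp.mpr (hTanti ha hb hab)) (Real.exp_pos _) hTeq

/-- **The GHL auxiliary function on the Siegel ball.** There is `r ∈ (0, 1/4]` (the Siegel radius)
such that for all constants `C ≥ 1`, `K ≥ 0` there is `A > 0` with: for every newform
`f ∈ S₂(Γ₀(N))` whose `L_f · corr` has the log-Euler product of `IsNewform0.symmSqL_mul_corr_eq_exp_logEuler`, every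
entire `L₄` which on `Re s > 1` is `exp` of the good-prime symmetric-fourth log series
(coefficients `(P_k⁴ - 3P_k² + 1)/k`) and satisfies `|L₄| ≤ C N^K` on `|s - 2| ≤ 3/2`, if
`L_f(1) < 1` and `β ∈ (1 - r, 1)` is a real zero of `L_f`, then
`G = ζ₁² (dslope (L_f·corr) β)³ L₄`, `Z = ζ² (L_f·corr)³ L₄`, `B = A log(N+2)` satisfy the
hypotheses of `GoldfeldHoffsteinLieman1994.realZero_le_local` with `m = 2`, `ρ = r` (log-coefficients of `Z` at `p^k ∤ N`:
`2 + 3(P_k² - 1) + (P_k⁴ - 3P_k² + 1) = P_k⁴ ≥ 0`). [cite: HoffsteinLockhart1994, Appendix (Goldfeld–Hoffstein–Lieman)] -/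
theorem exists_GHL_auxiliary_newform :
    ∃ r : ℝ, 0 < r ∧ r ≤ 1 / 4 ∧ (∀ s ∈ ball (2 : ℂ) (1 + 2 * r), 0 < s.re ∧ riemannZeta₁ s ≠ 0) ∧
      ∀ (C K : ℝ), 1 ≤ C → 0 ≤ K → ∃ A : ℝ, 0 < A ∧
        ∀ (N : ℕ) [NeZero N] (f : CuspForm (Gamma0 N) 2), IsNewform0 f →
          -- log-Euler product of `L_f · corr` (the statement of `IsNewform0.symmSqL_mul_corr_eq_exp_logEuler`)
          (∀ s : ℂ, 1 < s.re →
            (∀ p : Nat.Primes, Summable fun k : ℕ ↦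
              ‖((if ¬ (p : ℕ) ∣ N then
                    (((Polynomial.Chebyshev.C ℝ (k + 1)).eval ((cuspCoeff f p).re / Real.sqrt p)) ^ 2 - 1) /
                      (k + 1)
                  else if ¬ (p : ℕ) ^ 2 ∣ N then ((p : ℝ) ^ (k + 1))⁻¹ / (k + 1) else 0 : ℝ) : ℂ) *
                (p : ℂ) ^ (-((k + 1 : ℕ) : ℂ) * s)‖) ∧
            (Summable fun p : Nat.Primes ↦ ∑' k : ℕ,
              ‖((if ¬ (p : ℕ) ∣ N then
                    (((Polynomial.Chebyshev.C ℝ (k + 1)).eval ((cuspCoeff f p).re / Real.sqrt p)) ^ 2 - 1) /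
                      (k + 1)
                  else if ¬ (p : ℕ) ^ 2 ∣ N then ((p : ℝ) ^ (k + 1))⁻¹ / (k + 1) else 0 : ℝ) : ℂ) *
                (p : ℂ) ^ (-((k + 1 : ℕ) : ℂ) * s)‖) ∧
            symmSqL N f s * ∏ p ∈ N.primeFactors, (1 + (p : ℂ) ^ (-s)) =
              Complex.exp (∑' p : Nat.Primes, ∑' k : ℕ,
                ((if ¬ (p : ℕ) ∣ N then
                    (((Polynomial.Chebyshev.C ℝ (k + 1)).eval ((cuspCoeff f p).re / Real.sqrt p)) ^ 2 - 1) /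
                      (k + 1)
                  else if ¬ (p : ℕ) ^ 2 ∣ N then ((p : ℝ) ^ (k + 1))⁻¹ / (k + 1) else 0 : ℝ) : ℂ) *
                (p : ℂ) ^ (-((k + 1 : ℕ) : ℂ) * s))) →
          -- the symmetric-fourth data
          ∀ (L₄ : ℂ → ℂ), Differentiable ℂ L₄ →
            (∀ s : ℂ, 1 < s.re →
              (∀ p : Nat.Primes, Summable fun k : ℕ ↦
                ‖((if ¬ (p : ℕ) ∣ N then
                      (((Polynomial.Chebyshev.C ℝ (k + 1)).eval ((cuspCoeff f p).re / Real.sqrt p)) ^ 4 -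
                        3 * ((Polynomial.Chebyshev.C ℝ (k + 1)).eval ((cuspCoeff f p).re / Real.sqrt p)) ^ 2 +
                          1) / (k + 1)
                    else 0 : ℝ) : ℂ) * (p : ℂ) ^ (-((k + 1 : ℕ) : ℂ) * s)‖) ∧
              (Summable fun p : Nat.Primes ↦ ∑' k : ℕ,
                ‖((if ¬ (p : ℕ) ∣ N then
                      (((Polynomial.Chebyshev.C ℝ (k + 1)).eval ((cuspCoeff f p).re / Real.sqrt p)) ^ 4 -
                        3 * ((Polynomial.Chebyshev.C ℝ (k + 1)).eval ((cuspCoeff f p).re / Real.sqrt p)) ^ 2 +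
                          1) / (k + 1)
                    else 0 : ℝ) : ℂ) * (p : ℂ) ^ (-((k + 1 : ℕ) : ℂ) * s)‖) ∧
              L₄ s = Complex.exp (∑' p : Nat.Primes, ∑' k : ℕ,
                ((if ¬ (p : ℕ) ∣ N then
                      (((Polynomial.Chebyshev.C ℝ (k + 1)).eval ((cuspCoeff f p).re / Real.sqrt p)) ^ 4 -
                        3 * ((Polynomial.Chebyshev.C ℝ (k + 1)).eval ((cuspCoeff f p).re / Real.sqrt p)) ^ 2 +
                          1) / (k + 1)
                    else 0 : ℝ) : ℂ) * (p : ℂ) ^ (-((k + 1 : ℕ) : ℂ) * s))) →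
            (∀ s ∈ closedBall (2 : ℂ) (3 / 2), ‖L₄ s‖ ≤ C * (N : ℝ) ^ K) →
            (symmSqL N f 1).re < 1 →
            ∀ β : ℝ, 1 - r < β → β < 1 → symmSqL N f β = 0 →
              ∃ (G Z : ℂ → ℂ) (B : ℝ), 1 ≤ B ∧ B ≤ A * Real.log (N + 2) ∧
                DifferentiableOn ℂ G (ball (1 : ℂ) r) ∧
                (∀ s ∈ ball (1 : ℂ) r, ‖(s - β) ^ (2 + 1) * G s‖ ≤ Real.exp B) ∧
                (∀ s ∈ ball (1 : ℂ) r, G s = 0 → s.re ≤ 1) ∧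
                (∀ s ∈ ball (1 : ℂ) r, s ≠ 1 → (s - β) ^ (2 + 1) * G s = (s - 1) ^ 2 * Z s) ∧
                (∀ σ : ℝ, 1 < σ → σ < 1 + r → 1 ≤ ‖Z σ‖) ∧
                (∀ σ : ℝ, 1 < σ → σ < 1 + r → (deriv Z σ / Z σ).re ≤ 0) := by
  obtain ⟨r, hr0, hr4, hr, h⟩ := exists_GHL_auxiliary
  refine ⟨r, hr0, hr4, hr, fun C K hC hK ↦ ?_⟩
  obtain ⟨A, hA, hmain⟩ := h C K hC hK
  refine ⟨A, hA, fun N _ f _ hE L₄ hL₄d hL₄E hL₄b hL1 β hβ1 hβ2 hβ0 ↦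
    hmain N f _ _ ?_ hE L₄ hL₄d hL₄E hL₄b hL1 β hβ1 hβ2 hβ0⟩
  -- positivity of the combined log-coefficients: `2 + 3(P² - 1) + (P⁴ - 3P² + 1) = P⁴`
  intro p k
  split_ifs <;> first
    | positivity
    | (have hP := sq_nonneg
          (((Polynomial.Chebyshev.C ℝ (k + 1)).eval ((cuspCoeff f p).re / Real.sqrt p)) ^ 2)
       rw [mul_one_div, mul_div_assoc', ← add_div, ← add_div]
       exact div_nonneg (by nlinarith [hP]) (by positivity))

end SymmFourGHL

/-! ### Ramanujan at every good prime for the newform of an elliptic curve (Hasse) -/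

/-- **`|a_p(f)| ≤ 2√p`** for the newform `f` of an elliptic curve `W/ℚ` (`a_p(f) = a_p(W)`,
`IsNewformOf`) at every prime, from the tree's unconditional Hasse bound
`WeierstrassCurve.abs_LFunction_prime_pow_le` (Manin's elementary proof, `HasseElementary`).
[cite: SilvermanAEC2009, Thm. V.1.1] -/
theorem IsNewformOf.abs_re_cuspCoeff_le_two_mul_sqrt {N : ℕ} [NeZero N] {W : WeierstrassCurve ℚ}
    [W.IsElliptic] {f : CuspForm (Gamma0 N) 2} (hf : IsNewformOf W f) :
    ∀ p : ℕ, p.Prime → ¬ p ∣ N → |(cuspCoeff f p).re| ≤ 2 * Real.sqrt p := by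
  intro p hp _
  have h := WeierstrassCurve.abs_LFunction_prime_pow_le W hp 1
  rw [pow_one, pow_one, Nat.cast_one, show (1 : ℝ) + 1 = 2 by norm_num] at h
  rw [hf.2 p, Complex.intCast_re]
  exact h

/-! ### Goldfeld–Hoffstein–Lieman: no exceptional zero of `L_f` for non-CM elliptic newforms, from the `Sym⁴` package -/

/-- **Goldfeld–Hoffstein–Lieman for elliptic newforms, from the `Sym⁴` package.** Hasse's bound
and `Kim2003_symmFourL_nonCM_entire_polyBound` give an absolute constant `A > 0` such that for every
newform `f` of a NON-CM elliptic curve over `ℚ` of conductor `N` with `L_f(1) < 1`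
(`L_f = symmSqL N f`), `L_f(σ) ≠ 0` for `1 − 1/(A log(N + 2)) ≤ σ < 1`. (Printed: "`L(s, Sym² f)`
has no exceptional zero when `f` is not a lift from `GL(1)`"; Iwaniec–Kowalski Thm. 5.44 (2). The
proviso `L_f(1) < 1` is the self-improving device of the disc bound `exists_norm_symmSqL_le`; the
complementary case is trivial for the lower bound, see
`murty_petersson_newform_lower_bound_of_symmFour`.)
[cite: HoffsteinLockhart1994, Appendix (Goldfeld–Hoffstein–Lieman), Theorem] [cite: IwaniecKowalski2004, Thm. 5.44 (2)] -/
theorem symmSqL_nonCM_zeroFree_of_symmFour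
    (hSym4 : Literature.NumberTheory.Automorphic.Kim2003_symmFourL_nonCM_entire_polyBound) :
    ∃ A : ℝ, 0 < A ∧ ∀ (N : ℕ) [NeZero N] (W : WeierstrassCurve ℚ) [W.IsElliptic]
      (f : CuspForm (Gamma0 N) 2), IsNewformOf W f → ¬ W.HasCM → (symmSqL N f 1).re < 1 →
        ∀ σ : ℝ, 1 - 1 / (A * Real.log (N + 2)) ≤ σ → σ < 1 → symmSqL N f σ ≠ 0 := by
  obtain ⟨r, hr0, _hr4, _hr, hZE⟩ := SymmFourGHL.exists_GHL_auxiliary_newform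
  obtain ⟨C, K, hC, hK, h4⟩ := hSym4
  obtain ⟨A, hA, hZE'⟩ := hZE C K hC hK
  obtain ⟨c, hc, hGHL⟩ := GoldfeldHoffsteinLieman1994.realZero_le_local 2 hr0
  have hlog2 : (0 : ℝ) < Real.log 2 := Real.log_pos (by norm_num)
  refine ⟨max (2 * A / c) (2 / (r * Real.log 2)), lt_max_of_lt_left (by positivity), ?_⟩
  intro N _ W _ f hf hCM hL1 σ h1σ h2σ hzero
  set A' : ℝ := max (2 * A / c) (2 / (r * Real.log 2)) with hA'def
  have hA'0 : 0 < A' := lt_max_of_lt_left (by positivity)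
  have hN0 : (0 : ℝ) ≤ N := Nat.cast_nonneg N
  have hlogN : Real.log 2 ≤ Real.log (N + 2) := Real.log_le_log (by norm_num) (by linarith)
  have hlogN0 : 0 < Real.log (N + 2) := by linarith
  -- `1/(A' log(N+2)) ≤ r/2`, so `σ > 1 - r`
  have hr2 : 1 / (A' * Real.log (N + 2)) ≤ r / 2 := by
    have h1 : 2 / (r * Real.log 2) * Real.log 2 ≤ A' * Real.log (N + 2) :=
      mul_le_mul (le_max_right _ _) hlogN hlog2.le hA'0.le
    have h2 : 2 / (r * Real.log 2) * Real.log 2 = 2 / r := by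
      field_simp
    rw [h2] at h1
    rw [div_le_iff₀ (by positivity)]
    have := (div_le_iff₀ hr0).mp (le_refl (2 / r))
    nlinarith [h1, hr0]
  have hσr : 1 - r < σ := by linarith
  -- `1/(A' log(N+2)) ≤ (c/2)/(A log(N+2))`
  have hcA : 1 / (A' * Real.log (N + 2)) ≤ c / (2 * A * Real.log (N + 2)) := by
    rw [div_le_div_iff₀ (by positivity) (by positivity), one_mul]
    have h1 : 2 * A / c ≤ A' := le_max_left _ _
    have h2 : 2 * A ≤ A' * c := by rwa [div_le_iff₀ hc] at h1
    nlinarith [h2, hlogN0]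
  -- the data of the auxiliary function
  obtain ⟨L₄, hL₄d, hL₄E, hL₄b⟩ := h4 N W f hf hCM
  have hE := fun (s : ℂ) (hs : 1 < s.re) ↦
    hf.1.symmSqL_mul_corr_eq_exp_logEuler N f hf.abs_re_cuspCoeff_le_two_mul_sqrt hs
  obtain ⟨G, Z, B, hB1, hBA, hGd, hGb, hGz, hGZ, hZ1, hZ'⟩ :=
    hZE' N f hf.1 hE L₄ hL₄d hL₄E hL₄b hL1 σ hσr h2σ hzero
  have hβ := hGHL G Z B σ hB1 h2σ hGd hGb hGz hGZ hZ1 hZ'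
  -- `c/B ≥ c/(A log(N+2)) ≥ 2/(A' log(N+2))`: contradiction with `h1σ`
  have hB0 : 0 < B := by linarith
  have h3 : c / (A * Real.log (N + 2)) ≤ c / B :=
    div_le_div_of_nonneg_left hc.le hB0 hBA
  have h4' : c / (2 * A * Real.log (N + 2)) < c / (A * Real.log (N + 2)) := by
    apply div_lt_div_of_pos_left hc (by positivity)
    nlinarith [hA, hlogN0]
  linarith

/-! ### The named fact from the `Sym⁴` package alone -/

/-- **`murty_petersson_newform_lower_bound` follows from the analytic package of `L(s, Sym⁴ E)` for
non-CM `E/ℚ`** (the named fact `Kim2003_symmFourL_nonCM_entire_polyBound`): for every `ε > 0` there is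
`c > 0` with `c N^{1−ε} ≤ Re ⟨f, f⟩` for the newform `f` of every elliptic curve over `ℚ` of conductor
`N`. Non-CM curves: Goldfeld–Hoffstein–Lieman (`symmSqL_nonCM_zeroFree_of_symmFour`) and the case-A
engine `petersson_lower_bound_log_of_symmSqL_zeroFree` (`⟨f,f⟩ ≥ c₁N/log(N+2)`), or trivially when
`L_f(1) ≥ 1`; CM curves: `exists_petersson_ge_of_hasCM_of_j_ne_zero` (`j ≠ 0`) and
`exists_symmSqLOne_ge_of_j_eq_zero` (`j = 0`), theorems of the tree.
[cite: HoffsteinLockhart1994, Thm. 0.1 and Appendix] [cite: MurtyCongruencePrimes1999, §2] [cite: IwaniecKowalski2004, Cor. 5.45, (5.104)] -/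
theorem murty_petersson_newform_lower_bound_of_symmFour
    (hSym4 : Literature.NumberTheory.Automorphic.Kim2003_symmFourL_nonCM_entire_polyBound) :
    murty_petersson_newform_lower_bound := by
  obtain ⟨A, hA, hZF⟩ := symmSqL_nonCM_zeroFree_of_symmFour hSym4
  obtain ⟨A₀, _hA₀, h1⟩ := petersson_lower_bound_log_of_symmSqL_zeroFree
  obtain ⟨c₁, hc₁, hc₁N⟩ := h1 (max A A₀) (le_max_right _ _)
  intro ε hε
  obtain ⟨c₂, hc₂, h₂⟩ := exists_petersson_ge_of_hasCM_of_j_ne_zero hε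
  obtain ⟨c₃, hc₃, h₃⟩ := exists_symmSqLOne_ge_of_j_eq_zero hε
  have hπ := Real.pi_pos
  have h3ε : (0 : ℝ) < (3 : ℝ) ^ ε := Real.rpow_pos_of_pos (by norm_num) _
  refine ⟨min (min (1 / (8 * π ^ 3)) (c₁ * ε / (3 : ℝ) ^ ε)) (min c₂ (c₃ / (8 * π ^ 3))),
    by positivity, fun N _ W _ f hf ↦ ?_⟩
  have hN0' : N ≠ 0 := NeZero.ne N
  have hN0 : (0 : ℝ) < N := Nat.cast_pos.mpr (NeZero.pos N)
  have hN1 : (1 : ℝ) ≤ N := by exact_mod_cast NeZero.one_le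
  have hNε : (0 : ℝ) ≤ (N : ℝ) ^ (1 - ε) := Real.rpow_nonneg hN0.le _
  have hsplit : (N : ℝ) ^ (1 - ε) = (N : ℝ) ^ (-ε) * N := by
    rw [show (1 : ℝ) - ε = -ε + 1 by ring, Real.rpow_add hN0, Real.rpow_one]
  have hNle : (N : ℝ) ^ (1 - ε) ≤ N := by
    calc (N : ℝ) ^ (1 - ε) ≤ (N : ℝ) ^ (1 : ℝ) :=
          Real.rpow_le_rpow_of_exponent_le hN1 (by linarith)
      _ = N := Real.rpow_one _
  set P : ℝ := (peterssonProduct (Gamma0 N) 2 f f).re with hP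
  have hP0 : 0 ≤ P := re_peterssonProduct_self_nonneg f
  by_cases hj0 : W.j = 0
  · -- the family `j = 0`
    have key := h₃ ⟨N, W, f, hf⟩ hj0
    simp only [] at key
    rw [symmSqLOne_eq] at key
    -- `c₃ N^{-ε} ≤ 8π³ P / N`
    have h1 : c₃ * (N : ℝ) ^ (-ε) * N ≤ 8 * π ^ 3 * P := by
      have := (le_div_iff₀ hN0).mp key
      linarith
    calc min (min (1 / (8 * π ^ 3)) (c₁ * ε / (3 : ℝ) ^ ε)) (min c₂ (c₃ / (8 * π ^ 3))) * (N : ℝ) ^ (1 - ε)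
        ≤ c₃ / (8 * π ^ 3) * (N : ℝ) ^ (1 - ε) :=
          mul_le_mul_of_nonneg_right ((min_le_right _ _).trans (min_le_right _ _)) hNε
      _ = c₃ * (N : ℝ) ^ (-ε) * N / (8 * π ^ 3) := by rw [hsplit]; ring
      _ ≤ P := by rw [div_le_iff₀ (by positivity)]; linarith
  · by_cases hCM : W.HasCM
    · -- CM with `j ≠ 0`: the tree
      calc min (min (1 / (8 * π ^ 3)) (c₁ * ε / (3 : ℝ) ^ ε)) (min c₂ (c₃ / (8 * π ^ 3))) * (N : ℝ) ^ (1 - ε)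
          ≤ c₂ * (N : ℝ) ^ (1 - ε) :=
            mul_le_mul_of_nonneg_right ((min_le_right _ _).trans (min_le_left _ _)) hNε
        _ ≤ P := h₂ N W f hf hCM hj0
    · by_cases hL : 1 ≤ (symmSqL N f 1).re
      · -- `L_f(1) ≥ 1`: `P = [SL₂(ℤ):Γ₀(N)] L_f(1)/(8π³) ≥ N/(8π³)`
        have hidx : (N : ℝ) ≤ gamma0Index N := by exact_mod_cast le_gamma0Index hN0'
        have hidx0 : (0 : ℝ) < gamma0Index N := by exact_mod_cast gamma0Index_pos N
        rw [symmSqL_one, Complex.ofReal_re, le_div_iff₀ hidx0, one_mul] at hL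
        calc min (min (1 / (8 * π ^ 3)) (c₁ * ε / (3 : ℝ) ^ ε)) (min c₂ (c₃ / (8 * π ^ 3))) * (N : ℝ) ^ (1 - ε)
            ≤ 1 / (8 * π ^ 3) * (N : ℝ) ^ (1 - ε) :=
              mul_le_mul_of_nonneg_right ((min_le_left _ _).trans (min_le_left _ _)) hNε
          _ ≤ 1 / (8 * π ^ 3) * gamma0Index N :=
              mul_le_mul_of_nonneg_left (hNle.trans hidx) (by positivity)
          _ ≤ P := by rw [one_div_mul_eq_div, div_le_iff₀ (by positivity)]; linarith
      · -- `L_f(1) < 1`: zero-free interval (R1) and the case-A engine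
        push Not at hL
        have hlogN0 : 0 < Real.log (N + 2) := Real.log_pos (by linarith)
        have hAmax : 0 < max A A₀ := lt_of_lt_of_le hA (le_max_left _ _)
        have hZ' : ∀ σ : ℝ, 1 - 1 / (max A A₀ * Real.log (N + 2)) ≤ σ → σ < 1 →
            symmSqL N f σ ≠ 0 := by
          intro σ h1σ h2σ
          refine hZF N W f hf hCM hL σ (le_trans ?_ h1σ) h2σ
          have : 1 / (max A A₀ * Real.log (N + 2)) ≤ 1 / (A * Real.log (N + 2)) := by
            apply one_div_le_one_div_of_le (by positivity)
            exact mul_le_mul_of_nonneg_right (le_max_left _ _) hlogN0.le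
          linarith
        have hmain := hc₁N N f hf.1.2.2 hZ'
        have hlog : Real.log (N + 2) ≤ (3 : ℝ) ^ ε * (N : ℝ) ^ ε / ε := by
          have h1 : Real.log ((N : ℝ) + 2) ≤ ((N : ℝ) + 2) ^ ε / ε :=
            Real.log_le_rpow_div (by positivity) hε
          have h2 : ((N : ℝ) + 2) ^ ε ≤ (3 * (N : ℝ)) ^ ε :=
            Real.rpow_le_rpow (by linarith) (by linarith) hε.le
          rw [Real.mul_rpow (by norm_num) hN0.le] at h2
          calc Real.log ((N : ℝ) + 2) ≤ ((N : ℝ) + 2) ^ ε / ε := h1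
            _ ≤ (3 : ℝ) ^ ε * (N : ℝ) ^ ε / ε := by gcongr
        calc min (min (1 / (8 * π ^ 3)) (c₁ * ε / (3 : ℝ) ^ ε)) (min c₂ (c₃ / (8 * π ^ 3))) * (N : ℝ) ^ (1 - ε)
            ≤ c₁ * ε / (3 : ℝ) ^ ε * (N : ℝ) ^ (1 - ε) :=
              mul_le_mul_of_nonneg_right ((min_le_left _ _).trans (min_le_right _ _)) hNε
          _ = c₁ * N / ((3 : ℝ) ^ ε * (N : ℝ) ^ ε / ε) := by
              rw [Real.rpow_sub hN0, Real.rpow_one]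
              field_simp
          _ ≤ c₁ * N / Real.log (N + 2) := by
              apply div_le_div_of_nonneg_left (by positivity) hlogN0 hlog
          _ ≤ P := hmain

end Literature.NumberTheory.EllipticCurves.ModularForms

end
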